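import Literature.LinearAlgebra.Matrix.SymplecticIntegerPointsDense
import Mathlib.Data.ZMod.Basic
import HarnessLib

/-!
# The principal congruence subgroups `Γ(N)` of `Sp_{2l}(ℤ)`: finite index and Zariski density

Layer `Literature/LinearAlgebra/Matrix`, namespace `Literature.LinearAlgebra.Matrix.SymplecticMatrix`; lane
`lit-hodgefound` (Track 2), Layer A4, row **A4-39** (vii) of `run/shared/lean/pub/lit-hodgefound/SKELETON.md`
(§A4-DETAIL): the groups through which the monodromy of a universal family of principally polarised abelian
varieties WITH LEVEL-`N` STRUCTURE acts. Two definitions with bodies and their API; no named fact.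

* `SymplecticMatrix.mapHom f : Sp_{2l}(R) →* Sp_{2l}(R')` — functoriality of the symplectic group in the ring
  (`Aᵀ J A = J` is preserved by a ring homomorphism applied entrywise);
* `SymplecticMatrix.congruenceSubgroup l N = Γ(N) := ker (Sp_{2l}(ℤ) → Sp_{2l}(ℤ/Nℤ))`, with
  `mem_congruenceSubgroup_iff` (`M ∈ Γ(N) ↔ N ∣ (M - 1)_{ij}` for all `i, j`), normality, finite index for
  `N ≠ 0` (`index Γ(N) = #image ≤ #Sp_{2l}(ℤ/Nℤ) < ∞`), and the ZARISKI DENSITY of `Γ(N)` in `Sp_{2l}(ℝ)`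
  (`aeval_eq_zero_of_forall_mem_congruenceSubgroup`, from `SymplecticIntegerPointsDense` §5 — Margulis's
  Prop. (3.2.11) "every arithmetic subgroup of `G` is Zariski dense in `G`", the case of congruence subgroups
  of `Sp_{2g}(ℤ)`).

## References

* [Margulis1991] G. A. Margulis, *Discrete Subgroups of Semisimple Lie Groups* (1991), Chap. I (3.1.1)
  (arithmetic and congruence subgroups), Prop. (3.2.11) (Zariski density).
* [Lange2023AbelianVarietiesComplex] H. Lange, *Abelian Varieties over the Complex Numbers* (2023), §7.3.2 proof
  of Thm. 7.3.4 (the consumer: monodromy-stable Hodge classes, `ComplexTorusMonodromyStableHodgeClasses` §7).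
-/

open Matrix
open Literature.RepresentationTheory.HeisenbergGroup.SymplecticMatrix

namespace Literature.LinearAlgebra.Matrix.SymplecticMatrix

variable {l : Type*} [DecidableEq l] [Fintype l]

/-! ## §1. Functoriality of `Sp_{2l}` in the coefficient ring -/

section Map

variable {R R' : Type*} [CommRing R] [CommRing R'] (f : R →+* R')

/-- A ring homomorphism applied entrywise carries symplectic matrices to symplectic matrices
(`A J Aᵀ = J` is a polynomial identity). [cite: Margulis1991, Chap. I (3.1.1) (the `ℤ`-structure on `G` and its reductions)] -/
theorem map_mem_symplecticGroup {A : Matrix (l ⊕ l) (l ⊕ l) R} (hA : A ∈ Matrix.symplecticGroup l R) :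
    A.map f ∈ Matrix.symplecticGroup l R' := by
  rw [SymplecticGroup.mem_iff] at hA ⊢
  have h := congrArg (fun B : Matrix (l ⊕ l) (l ⊕ l) R ↦ B.map f) hA
  simp only [Matrix.map_mul, Matrix.transpose_map, Matrix.map_J] at h
  exact h

/-- **`Sp_{2l}(f) : Sp_{2l}(R) →* Sp_{2l}(R')`**, the group homomorphism induced by a ring homomorphism
`f : R → R'` (e.g. reduction modulo `N`). [cite: Margulis1991, Chap. I (3.1.1)] -/
def mapHom : Matrix.symplecticGroup l R →* Matrix.symplecticGroup l R' where
  toFun A := ⟨(A : Matrix (l ⊕ l) (l ⊕ l) R).map f, map_mem_symplecticGroup f A.2⟩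
  map_one' := Subtype.ext (by
    change ((1 : Matrix.symplecticGroup l R) : Matrix (l ⊕ l) (l ⊕ l) R).map f = 1
    rw [OneMemClass.coe_one, Matrix.map_one f (map_zero f) (map_one f)])
  map_mul' A B := Subtype.ext (by
    change ((A * B : Matrix.symplecticGroup l R) : Matrix (l ⊕ l) (l ⊕ l) R).map f =
      (A : Matrix (l ⊕ l) (l ⊕ l) R).map f * (B : Matrix (l ⊕ l) (l ⊕ l) R).map f
    rw [Submonoid.coe_mul, Matrix.map_mul])

/-- The matrix of `Sp_{2l}(f)(A)` is `f` applied entrywise. [cite: Margulis1991, Chap. I (3.1.1)] -/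
@[simp] theorem coe_mapHom (A : Matrix.symplecticGroup l R) :
    ((mapHom f A : Matrix.symplecticGroup l R') : Matrix (l ⊕ l) (l ⊕ l) R') =
      (A : Matrix (l ⊕ l) (l ⊕ l) R).map f := rfl

end Map

/-! ## §2. The principal congruence subgroup `Γ(N)` -/

section Congruence

variable (l)

/-- **The principal congruence subgroup `Γ(N) ⊆ Sp_{2l}(ℤ)` of level `N`**: the kernel of the reduction
`Sp_{2l}(ℤ) → Sp_{2l}(ℤ/Nℤ)`, i.e. the integral symplectic matrices `≡ 1 (mod N)` ("a subgroup of `G(ℤ)`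
containing the kernel of the reduction modulo some `N` — a congruence subgroup").
[cite: Margulis1991, Chap. I (3.1.1)] -/
def congruenceSubgroup (N : ℕ) : Subgroup (Matrix.symplecticGroup l ℤ) :=
  (mapHom (l := l) (Int.castRingHom (ZMod N))).ker

variable {l}

/-- `M ∈ Γ(N)` iff the reduction of `M` modulo `N` is the identity. [cite: Margulis1991, Chap. I (3.1.1)] -/
theorem mem_congruenceSubgroup_iff_map {N : ℕ} {M : Matrix.symplecticGroup l ℤ} :
    M ∈ congruenceSubgroup l N ↔ (M : Matrix (l ⊕ l) (l ⊕ l) ℤ).map (Int.castRingHom (ZMod N)) = 1 := by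
  rw [congruenceSubgroup, MonoidHom.mem_ker, Subtype.ext_iff, coe_mapHom, OneMemClass.coe_one]

/-- **`M ∈ Γ(N) ↔ M ≡ 1 (mod N)` entrywise.** [cite: Margulis1991, Chap. I (3.1.1)] -/
theorem mem_congruenceSubgroup_iff {N : ℕ} {M : Matrix.symplecticGroup l ℤ} :
    M ∈ congruenceSubgroup l N ↔ ∀ i j, (N : ℤ) ∣ ((M : Matrix (l ⊕ l) (l ⊕ l) ℤ) - 1) i j := by
  rw [mem_congruenceSubgroup_iff_map, ← Matrix.ext_iff]
  refine forall_congr' fun i ↦ forall_congr' fun j ↦ ?_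
  rw [Matrix.map_apply, Matrix.sub_apply, ← ZMod.intCast_zmod_eq_zero_iff_dvd, Int.cast_sub, sub_eq_zero,
    eq_intCast, Matrix.one_apply, Matrix.one_apply]
  split_ifs <;> simp

/-- `Γ(N)` is a normal subgroup of `Sp_{2l}(ℤ)` (a kernel). [cite: Margulis1991, Chap. I (3.1.1)] -/
instance congruenceSubgroup_normal (N : ℕ) : (congruenceSubgroup l N).Normal := by
  unfold congruenceSubgroup
  infer_instance

/-- `Γ(1) = Sp_{2l}(ℤ)` (reduction modulo `1` kills everything). [cite: Margulis1991, Chap. I (3.1.1)] -/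
theorem congruenceSubgroup_one : congruenceSubgroup l 1 = ⊤ := by
  refine (Subgroup.eq_top_iff' _).2 fun M ↦ mem_congruenceSubgroup_iff.2 fun i j ↦ ?_
  rw [Nat.cast_one]
  exact one_dvd _

/-- `Γ(0) = {1}`: reduction modulo `0` is injective (`ℤ/0ℤ = ℤ`). [cite: Margulis1991, Chap. I (3.1.1)] -/
theorem mem_congruenceSubgroup_zero_iff {M : Matrix.symplecticGroup l ℤ} : M ∈ congruenceSubgroup l 0 ↔ M = 1 := by
  rw [mem_congruenceSubgroup_iff, Subtype.ext_iff, OneMemClass.coe_one, ← sub_eq_zero, ← Matrix.ext_iff]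
  refine forall_congr' fun i ↦ forall_congr' fun j ↦ ?_
  rw [Nat.cast_zero, zero_dvd_iff, Matrix.zero_apply]

/-- **`Γ(N)` has finite index in `Sp_{2l}(ℤ)` for `N ≠ 0`**: `[Sp_{2l}(ℤ) : Γ(N)] = #im(Sp_{2l}(ℤ) → Sp_{2l}(ℤ/N))`,
a subgroup of the finite group `Sp_{2l}(ℤ/Nℤ)`. [cite: Margulis1991, Chap. I (3.1.1) (congruence subgroups are arithmetic)] -/
instance finiteIndex_congruenceSubgroup (N : ℕ) [NeZero N] : (congruenceSubgroup l N).FiniteIndex := by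
  refine ⟨?_⟩
  rw [congruenceSubgroup, Subgroup.index_ker]
  exact Nat.card_pos.ne'

/-- The index formula `[Sp_{2l}(ℤ) : Γ(N)] = #(image of the reduction)`. [cite: Margulis1991, Chap. I (3.1.1)] -/
theorem index_congruenceSubgroup (N : ℕ) :
    (congruenceSubgroup l N).index = Nat.card (mapHom (l := l) (Int.castRingHom (ZMod N))).range := by
  rw [congruenceSubgroup, Subgroup.index_ker]

/-- Root unipotents of level `N`: `n(N b) ∈ Γ(N)` for every integral symmetric `b` (so `Γ(N)` is Zariski dense
for `N ≠ 0`, §3). [cite: Margulis1991, Chap. I (3.1.1) and Prop. (3.2.11)] -/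
theorem unip_mem_congruenceSubgroup (N : ℕ) (b : Matrix l l ℤ) (hb : b.IsSymm) :
    (unip ((N : ℤ) • b) (hb.smul (N : ℤ)) : Matrix.symplecticGroup l ℤ) ∈ congruenceSubgroup l N := by
  rw [mem_congruenceSubgroup_iff]
  intro i j
  rw [coe_unip, Matrix.sub_apply, ← fromBlocks_one]
  rcases i with i | i <;> rcases j with j | j
  · simp [fromBlocks_apply₁₁]
  · rw [fromBlocks_apply₁₂, fromBlocks_apply₁₂, Matrix.smul_apply, Matrix.zero_apply, sub_zero, smul_eq_mul]
    exact dvd_mul_right _ _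
  · simp [fromBlocks_apply₂₁]
  · simp [fromBlocks_apply₂₂]

end Congruence

/-! ## §3. Zariski density of `Γ(N)` in `Sp_{2l}(ℝ)` -/

section Density

variable {S : Type*} [CommRing S] [Algebra ℝ S] [IsDomain S] [CharZero S]

/-- **`Γ(N)` is Zariski dense in `Sp_{2l}(ℝ)`** (`N ≠ 0`): a polynomial in the matrix entries with coefficients in a
characteristic-`0` domain `S ⊇ ℝ` vanishing on `Γ(N)` vanishes on `Sp_{2l}(ℝ)` — Margulis, Chap. I Prop. (3.2.11)
("every arithmetic subgroup of `G` is Zariski dense in `G`") for the congruence subgroups of `Sp_{2g}(ℤ)`.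
[cite: Margulis1991, Chap. I Prop. (3.2.11)] -/
theorem aeval_eq_zero_of_forall_mem_congruenceSubgroup (N : ℕ) [NeZero N]
    (f : MvPolynomial ((l ⊕ l) × (l ⊕ l)) S)
    (hf : ∀ M : Matrix.symplecticGroup l ℤ, M ∈ congruenceSubgroup l N →
      MvPolynomial.aeval (fun ij : (l ⊕ l) × (l ⊕ l) ↦
        algebraMap ℝ S (((M : Matrix (l ⊕ l) (l ⊕ l) ℤ).map (Int.castRingHom ℝ)) ij.1 ij.2)) f = 0)
    {A : Matrix (l ⊕ l) (l ⊕ l) ℝ} (hA : A ∈ Matrix.symplecticGroup l ℝ) :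
    MvPolynomial.aeval (fun ij : (l ⊕ l) × (l ⊕ l) ↦ algebraMap ℝ S (A ij.1 ij.2)) f = 0 :=
  aeval_eq_zero_of_forall_mem_of_finiteIndex (congruenceSubgroup l N) f hf hA

/-- Entrywise congruence form: a polynomial vanishing at every integral symplectic `M ≡ 1 (mod N)` (`N ≠ 0`)
vanishes on `Sp_{2l}(ℝ)`. [cite: Margulis1991, Chap. I Prop. (3.2.11)] -/
theorem aeval_eq_zero_of_forall_modEq_one (N : ℕ) [NeZero N]
    (f : MvPolynomial ((l ⊕ l) × (l ⊕ l)) S)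
    (hf : ∀ M : Matrix (l ⊕ l) (l ⊕ l) ℤ, M ∈ Matrix.symplecticGroup l ℤ → (∀ i j, (N : ℤ) ∣ (M - 1) i j) →
      MvPolynomial.aeval (fun ij : (l ⊕ l) × (l ⊕ l) ↦
        algebraMap ℝ S ((M.map (Int.castRingHom ℝ)) ij.1 ij.2)) f = 0)
    {A : Matrix (l ⊕ l) (l ⊕ l) ℝ} (hA : A ∈ Matrix.symplecticGroup l ℝ) :
    MvPolynomial.aeval (fun ij : (l ⊕ l) × (l ⊕ l) ↦ algebraMap ℝ S (A ij.1 ij.2)) f = 0 :=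
  aeval_eq_zero_of_forall_mem_congruenceSubgroup N f
    (fun M hM ↦ hf M M.2 (mem_congruenceSubgroup_iff.1 hM)) hA

end Density

end Literature.LinearAlgebra.Matrix.SymplecticMatrix
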